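import Summits.FinalStateConjecture.FinalStateConjecture.Theorems.PhaseMixingCaptureBulkKerrCaptureC2SlabPairContDiff
import Summits.FinalStateConjecture.FinalStateConjecture.Theorems.PhaseMixingCaptureBulkKerrCaptureC2TeukolskyOpDilate
import Summits.FinalStateConjecture.FinalStateConjecture.Theorems.PhaseMixingCaptureBulkKerrCaptureC2SlabPairDilate
import Summits.FinalStateConjecture.FinalStateConjecture.Theorems.PhaseMixingCaptureBulkKerrCaptureC2TeukolskyEnergyDilate
import Summits.FinalStateConjecture.FinalStateConjecture.Theorems.PhaseMixingCaptureBulkKerrCaptureC2SlabLawDilate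
import HarnessLib

/-!
# Mass scaling of the Teukolsky slab law: dilation covariance assembled, radius antitonicity,
# and the bounded-κ law at every mass from the law at unit mass

Helper file (lead c6) of the line `bounded-kappa-closing-box` for the crux `BulkKerrCaptureC2`
(stmt-FinalStateConjecture-14985, route `PhaseMixingCapture`). The Kerr family is homothetic —
`g_{λM,λa}(λx) = g_{M,a}(x)` in Kerr–Schild Cartesian coordinates (`Kerr.bilin_dilate`) —, so the
DHRT (1.3)-format black-box law `Kerr.TeukolskySlabLawOn M a r₀ k w R Λ` (sourced spin-±2 pairs on time
slabs of the horizon-penetrating chart `{r > r₀}`; Dafermos–Holzegel–Rodnianski–Taylor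
arXiv:2212.14093, §1.1 (1.3)) transports along the dilations `x ↦ λx` with a constant uniform for `λ`
in a compact range. The five analytic pieces were landed separately by the line's stub-workers:

* `SlabPairContDiff.stub_slabPair_contDiffAt` (p120331) — fields of slab pairs are `C^∞` off the
  axis and off `{Δ = 0}`;
* `TeukolskyOpDilate.stub_teukolskyOpOn_dilate` (p120876) — `𝔗_{M,a,r₀}[α ∘ D_λ](x) = 𝔗_{λM,λa,λr₀}[α](λx)`;
* `SlabPairDilate.stub_slabPair_dilate` (p121404) — slab pairs pull back along `D_λ`;
* `TeukolskyEnergyDilate.stub_teukolskyEnergyOn_dilate` (p122447) — two-sided comparison of the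
  weighted energies;
* `SlabLawDilate.stub_slabLaw_dilate` (p122941) — the law transports, given the previous two.

This file assembles them (`slabLaw_dilate`), records the antitonicity of the law in the locality
radius (`slabLaw_anti_radius`), and proves the reduction used by the line's skeleton: the bounded-κ
slab law at EVERY mass `M ∈ [M₀/2, 2M₀]` (the line's former linear stub `L`) follows from the
a-uniform law AT UNIT MASS (the line's registered stub `L₁ = stub_unitMassSlabLaw`)
(`stub_bulkSlabLaw_of_unitMassSlabLaw`, registered on the crux item as a sub-goal so that this helper file lands
`--supports`). Everything here is proved; no named facts.
-/

-- the doubled `FinalStateConjecture.FinalStateConjecture` path component trips dupNamespace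
set_option linter.dupNamespace false

noncomputable section

namespace Summit.FinalStateConjecture.FinalStateConjecture.Theorems.BulkKerrCaptureC2.SlabLawScaling

open Literature.Geometry.Lorentzian
open Set MeasureTheory
open scoped Pointwise ENNReal

/-- **Dilation covariance of the Teukolsky slab law** (assembled): for `λ` in a compact range
`[lo, hi] ⊂ (0, ∞)` ONE constant `K = K(k, w, lo, hi) ≥ 1` gives
`TeukolskySlabLawOn M a r₀ k w R Λ → TeukolskySlabLawOn (λM) (λa) (λr₀) k w (λR) (KΛ)` for all
`(M, a, r₀, R)` and `Λ ≥ 0` — the five landed stubs composed (`stub_slabLaw_dilate` fed with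
`stub_slabPair_dilate stub_teukolskyOpOn_dilate stub_slabPair_contDiffAt` and
`stub_teukolskyEnergyOn_dilate`). Kerr–Schild 1965, §2 (homothety of the family);
DHRT arXiv:2212.14093, (1.3) (the format). [cite: KerrSchild1965, §2] -/
theorem slabLaw_dilate :
    ∀ [Kerr.Facts] (k : ℕ) (w lo hi : ℝ), 0 < lo → lo ≤ hi → ∃ K : ℝ, 1 ≤ K ∧
      ∀ lam : ℝ, lo ≤ lam → lam ≤ hi → ∀ (M a r₀ R Λ : ℝ), 0 ≤ Λ →
        Kerr.TeukolskySlabLawOn M a r₀ k w R Λ →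
        Kerr.TeukolskySlabLawOn (lam * M) (lam * a) (lam * r₀) k w (lam * R) (K * Λ) :=
  SlabLawDilate.stub_slabLaw_dilate
    (SlabPairDilate.stub_slabPair_dilate TeukolskyOpDilate.stub_teukolskyOpOn_dilate
      SlabPairContDiff.stub_slabPair_contDiffAt)
    TeukolskyEnergyDilate.stub_teukolskyEnergyOn_dilate

/-- **The slab law is antitone in the locality radius `R`**: the local first-order energy through
`{‖y‖ ≤ R}` is monotone in the ball (`Kerr.teukolskyEnergyOn_mono`), so a law for the ball of
radius `R'` gives the law for every `R ≤ R'` with the same constant. DHRT arXiv:2212.14093, (1.3).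
[folklore] -/
theorem slabLaw_anti_radius [Kerr.Facts] {M a r₀ : ℝ} {k : ℕ} {w R R' Λ : ℝ}
    (h : Kerr.TeukolskySlabLawOn M a r₀ k w R' Λ) (hR : R ≤ R') :
    Kerr.TeukolskySlabLawOn M a r₀ k w R Λ := by
  intro _ s hs τ₀ τ₁ hτ α F hαF
  have hsub : Metric.closedBall (0 : E3) R ⊆ Metric.closedBall 0 R' :=
    Metric.closedBall_subset_closedBall hR
  exact le_trans (add_le_add (Kerr.teukolskyEnergyOn_mono M a r₀ s α τ₁ 1 0 hsub)
    (lintegral_mono fun τ ↦ Kerr.teukolskyEnergyOn_mono M a r₀ s α τ 1 0 hsub))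
    (h s hs τ₀ τ₁ hτ α F hαF)

/-- The weighted coordinate energy `sliceSobolevEnergy` is monotone in the regularity `k` and in the
weight exponent `p` (the weight base `1 + ‖y‖` is `≥ 1`, and more derivative orders are summed).
Dafermos–Rodnianski arXiv:0811.0354, §4. [cite: arXiv08110354, §4] -/
theorem sliceSobolevEnergy_mono_regularity {G : Type*} [NormedAddCommGroup G] [NormedSpace ℝ G]
    (U : TopologicalSpace.Opens E4) (f : U → G) (τ : ℝ) {k k' : ℕ} {p p' : ℝ}
    (hk : k ≤ k') (hp : p ≤ p') (A : Set E3) :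
    sliceSobolevEnergy U f τ k p A ≤ sliceSobolevEnergy U f τ k' p' A := by
  unfold sliceSobolevEnergy
  refine lintegral_mono fun y ↦ ?_
  refine Set.indicator_le_indicator ?_
  refine ENNReal.ofReal_le_ofReal ?_
  have h1 : (1 : ℝ) ≤ 1 + ‖y‖ := by linarith [norm_nonneg y]
  refine mul_le_mul (Real.rpow_le_rpow_of_exponent_le h1 hp) ?_
    (Finset.sum_nonneg fun _ _ ↦ sq_nonneg _) (Real.rpow_nonneg (by linarith) _)
  exact Finset.sum_le_sum_of_subset_of_nonneg (Finset.range_mono (by omega)) fun _ _ _ ↦ sq_nonneg _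

/-- `Kerr.teukolskyEnergyOn` is monotone in `(k, p)`. [cite: arXiv08110354, §4] -/
theorem teukolskyEnergyOn_mono_regularity (M a r₀ : ℝ) (s : ℤ) (α : Kerr.region a r₀ → ℂ) (τ : ℝ)
    {k k' : ℕ} {p p' : ℝ} (hk : k ≤ k') (hp : p ≤ p') (A : Set E3) :
    Kerr.teukolskyEnergyOn M a r₀ s α τ k p A ≤ Kerr.teukolskyEnergyOn M a r₀ s α τ k' p' A :=
  sliceSobolevEnergy_mono_regularity _ _ τ hk hp A

/-- **The slab law is monotone in the regularity `(k, w)` of its right-hand side**: a law at `(k, w)`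
gives the law at every `(k', w')` with `k ≤ k'`, `w ≤ w'` and the same constant (the right-hand
energies only grow). So the regularity witnessed by an `∃ (k, w)`-statement of the law (the line's
stub `stub_unitMassSlabLaw`) is an up-set: any printed regularity suffices. DHRT arXiv:2212.14093,
(1.3). [folklore] -/
theorem slabLaw_mono_regularity [Kerr.Facts] {M a r₀ : ℝ} {k k' : ℕ} {w w' R Λ : ℝ}
    (h : Kerr.TeukolskySlabLawOn M a r₀ k w R Λ) (hk : k ≤ k') (hw : w ≤ w') :
    Kerr.TeukolskySlabLawOn M a r₀ k' w' R Λ := by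
  intro _ s hs τ₀ τ₁ hτ α F hαF
  refine (h s hs τ₀ τ₁ hτ α F hαF).trans ?_
  gcongr ENNReal.ofReal Λ * (?_ + ?_)
  · exact teukolskyEnergyOn_mono_regularity M a r₀ s α τ₀ hk hw univ
  · exact lintegral_mono fun σ ↦ teukolskyEnergyOn_mono_regularity M a r₀ s F σ hk hw univ

/-- **The bounded-κ slab law at every mass from the law at unit mass.** If for a threshold `a₁`
ONE regularity `(k, w)` and, per radius `R`, ONE constant `C ≥ 1` give
`Kerr.TeukolskySlabLawOn 1 a 1 k w R C` for every `|a| ≤ a₁` (the line's registered stub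
`stub_unitMassSlabLaw`, body inlined as the hypothesis), then for every mass scale `M₀ > 0` and
radius `R` ONE constant serves every `M ∈ [M₀/2, 2M₀]` and `|a| ≤ a₁M` on the chart `{r > M}`:
dilate by `λ := M` from `(1, a/M, 1)` at radius `R₁ := 2|R|/M₀` (`slabLaw_dilate` on
`[M₀/2, 2M₀]`), then shrink the ball from `M R₁ ≥ R` to `R` (`slabLaw_anti_radius`). This is the
mass-local uniformity of the line's former linear stub `L` (skeleton v2), now a theorem of `L₁`.
[cite: KerrSchild1965, §2] -/
theorem stub_bulkSlabLaw_of_unitMassSlabLaw :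
    (∀ [Kerr.Facts], ∀ a₁ : ℝ, a₁ < 1 → ∃ (k : ℕ) (w : ℝ), ∀ R : ℝ, ∃ C : ℝ, 1 ≤ C ∧
      ∀ a : ℝ, |a| ≤ a₁ → Kerr.TeukolskySlabLawOn 1 a 1 k w R C) →
    ∀ [Kerr.Facts], ∀ a₁ : ℝ, a₁ < 1 → ∃ (k : ℕ) (w : ℝ),
      ∀ M₀ : ℝ, 0 < M₀ → ∀ R : ℝ, ∃ C : ℝ, 1 ≤ C ∧ ∀ M : ℝ, M₀ / 2 ≤ M → M ≤ 2 * M₀ →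
        ∀ a : ℝ, |a| ≤ a₁ * M → Kerr.TeukolskySlabLawOn M a M k w R C := by
  intro hL₁ _ a₁ ha₁
  obtain ⟨k, w, hkw⟩ := hL₁ a₁ ha₁
  refine ⟨k, w, fun M₀ hM₀ R ↦ ?_⟩
  obtain ⟨C₁, hC₁, hlaw₁⟩ := hkw (2 * |R| / M₀)
  obtain ⟨K, hK, hdil⟩ := slabLaw_dilate k w (M₀ / 2) (2 * M₀) (by positivity) (by linarith)
  refine ⟨K * C₁, one_le_mul_of_one_le_of_one_le hK hC₁, fun M hlo hhi a ha ↦ ?_⟩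
  have hM : 0 < M := by linarith
  have ha' : |a / M| ≤ a₁ := by
    rw [abs_div, abs_of_pos hM, div_le_iff₀ hM]
    exact ha
  have h₂ : Kerr.TeukolskySlabLawOn (M * 1) (M * (a / M)) (M * 1) k w (M * (2 * |R| / M₀)) (K * C₁) :=
    hdil M hlo hhi 1 (a / M) 1 (2 * |R| / M₀) C₁ (by linarith) (hlaw₁ (a / M) ha')
  have e₁ : M * (a / M) = a := by field_simp
  -- transport along the parameter identities `M * 1 = M`, `M * (a / M) = a`
  have key : ∀ M' a' r' : ℝ, M' = M → a' = a → r' = M →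
      Kerr.TeukolskySlabLawOn M' a' r' k w (M * (2 * |R| / M₀)) (K * C₁) →
      Kerr.TeukolskySlabLawOn M a M k w (M * (2 * |R| / M₀)) (K * C₁) := by
    rintro _ _ _ rfl rfl rfl h
    exact h
  have h₃ : Kerr.TeukolskySlabLawOn M a M k w (M * (2 * |R| / M₀)) (K * C₁) :=
    key (M * 1) (M * (a / M)) (M * 1) (mul_one M) e₁ (mul_one M) h₂
  have hR : R ≤ M * (2 * |R| / M₀) :=
    calc R ≤ |R| := le_abs_self R
      _ = M₀ / 2 * (2 * |R| / M₀) := by field_simp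
      _ ≤ M * (2 * |R| / M₀) := mul_le_mul_of_nonneg_right hlo (by positivity)
  have h₄ : Kerr.TeukolskySlabLawOn M a M k w R (K * C₁) := slabLaw_anti_radius h₃ hR
  -- `assumption`, not `exact h₄`: the def's leading instance binder makes `exact` auto-insert an
  -- instance argument it cannot synthesise.
  assumption

end Summit.FinalStateConjecture.FinalStateConjecture.Theorems.BulkKerrCaptureC2.SlabLawScaling

end
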